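import Summits.ResolutionOfSingularities.ResolutionOfSingularities.Theorems.FrobeniusClosingSteerVertexDescentWords
import HarnessLib

/-!
# Crux `Steer` (stmt-ResolutionOfSingularities-16345), chain W4.1 — §11 DESCENT TRIO FILE 1A: toolkit for `VertexShiftRigidity`
# (algebra-map calculus of `vertexShift` and of «killing `M`», support bookkeeping for the removable span, chain rules)

OURS (campaign `res-hironaka`, rung L ★L-G4, slot W4.1; kernel lemmas about the route's own words of FILE 0
`…Theorems.FrobeniusClosingSteerVertexDescentWords` (p549379); they replace the role of no printed item and are NOT statements of the
manuscript under review [claim: Hironaka2017, status: under-review]; AI-produced, AI review is weaker than expert review). Seat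
res-D-repro-2 g9 on custody res-plan-2 IDLE POOL DEAL #30 (4) and res-L0-w41-plan-1 RULING 189c (FILE 1 = `vertexShiftRigidity_holds`,
split A/B for length: this file A = preliminaries, file B `…SteerVertexShiftRigidity` = the translation sublemma and the theorem).
Mathematics: res-L0-w41-idea-1 g10, memo `CANONICAL-CLEANING-g10.md` 2ea9717796005c14 §11. Def-free; Mathlib + the Words file only;
no Theses import; nothing here is a route item or a registration.

Contents (all over a commutative ring `κ`, `R = κ[Z, W, M] = MvPolynomial (Fin 3) κ`, indices `0 = Z`, `1 = W`, `2 = M`):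
* `vertexShift_X_zero/_one/_two`, `vertexShift_comp`, `vertexShift_vertexShift` — shifts act on generators and compose additively;
* «killing `M`» = `aeval ![X 0, X 1, 0]`: `cone_comp_vertexShift` (`F(Z + c₁M, W + c₂M, M)|_{M=0} = F|_{M=0}`), `cone_comp_cone`,
  `coeff_cone` (coefficient formula), `cone_eq_self_of_forall`, `apply_two_eq_zero_of_mem_support_cone`, `coeff_sub_cone`;
* per-monomial support bookkeeping `forall_support_sub/add/mul/mul_left/pow/C_mul_monomial/sum` and the STABILITY OF THE REMOVABLE
  SPAN `vertexShift_removable` (characteristic `2`: `(Z + t₁M)^{2i}(W + t₂M)^{2j}M^k = (Z² + t₁²M²)^i(W² + t₂²M²)^jM^k`);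
* derivatives: `pderiv_eq_zero_of_forall_even` (characteristic `2`), chain rules `pderiv_zero/one_vertexShift`, `pderiv_zero/one_cone`.
[folklore]
-/

-- `Summit.<S>.<S>.…` duplicates the summit name by design (single-problem summit).
set_option linter.dupNamespace false
set_option autoImplicit false

namespace Summit.ResolutionOfSingularities.ResolutionOfSingularities.Theorems.SwitchingDichotomy.VertexDescent

open MvPolynomial

section AlgebraMaps

variable {κ : Type} [CommRing κ]

/-- `vertexShift` on the generator `Z = X 0`. [folklore] -/
@[simp] theorem vertexShift_X_zero (c₁ c₂ : κ) :
    vertexShift c₁ c₂ (X 0 : MvPolynomial (Fin 3) κ) = X 0 + C c₁ * X 2 := by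
  simp [vertexShift]

/-- `vertexShift` on the generator `W = X 1`. [folklore] -/
@[simp] theorem vertexShift_X_one (c₁ c₂ : κ) :
    vertexShift c₁ c₂ (X 1 : MvPolynomial (Fin 3) κ) = X 1 + C c₂ * X 2 := by
  simp [vertexShift]

/-- `vertexShift` fixes the generator `M = X 2`. [folklore] -/
@[simp] theorem vertexShift_X_two (c₁ c₂ : κ) :
    vertexShift c₁ c₂ (X 2 : MvPolynomial (Fin 3) κ) = X 2 := by
  simp [vertexShift]

/-- Vertex shifts compose additively. [folklore] -/
theorem vertexShift_comp (a₁ a₂ b₁ b₂ : κ) :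
    (vertexShift a₁ a₂).comp (vertexShift b₁ b₂) = vertexShift (a₁ + b₁) (a₂ + b₂) := by
  refine MvPolynomial.algHom_ext fun i => ?_
  fin_cases i <;> simp [map_add, map_mul] <;> ring

/-- Vertex shifts compose additively (applied form). [folklore] -/
theorem vertexShift_vertexShift (a₁ a₂ b₁ b₂ : κ) (F : MvPolynomial (Fin 3) κ) :
    vertexShift a₁ a₂ (vertexShift b₁ b₂ F) = vertexShift (a₁ + b₁) (a₂ + b₂) F := by
  rw [← AlgHom.comp_apply, vertexShift_comp]

/-- Killing `M` after a vertex shift is killing `M`: `F(Z + c₁M, W + c₂M, M)|_{M=0} = F(Z, W, 0)`. [folklore] -/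
theorem cone_comp_vertexShift (c₁ c₂ : κ) :
    (aeval ![X 0, X 1, (0 : MvPolynomial (Fin 3) κ)]).comp (vertexShift c₁ c₂) =
      aeval ![X 0, X 1, (0 : MvPolynomial (Fin 3) κ)] := by
  refine MvPolynomial.algHom_ext fun i => ?_
  fin_cases i <;> simp

/-- Killing `M` is idempotent. [folklore] -/
theorem cone_comp_cone :
    (aeval ![X 0, X 1, (0 : MvPolynomial (Fin 3) κ)]).comp (aeval ![X 0, X 1, (0 : MvPolynomial (Fin 3) κ)]) =
      aeval ![X 0, X 1, (0 : MvPolynomial (Fin 3) κ)] := by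
  refine MvPolynomial.algHom_ext fun i => ?_
  fin_cases i <;> simp

/-- Coefficients after killing `M`: the `M`-free monomials keep their coefficient, the others vanish. [folklore] -/
theorem coeff_cone (G : MvPolynomial (Fin 3) κ) (m : Fin 3 →₀ ℕ) :
    coeff m (aeval ![X 0, X 1, (0 : MvPolynomial (Fin 3) κ)] G) = if m 2 = 0 then coeff m G else 0 := by
  classical
  induction G using MvPolynomial.induction_on' with
  | monomial n a =>
    rw [aeval_monomial, Finsupp.prod_fintype _ _ (fun i => by simp), Fin.prod_univ_three]
    simp only [Matrix.cons_val_zero, Matrix.cons_val_one, Matrix.cons_val, algebraMap_eq, coeff_monomial]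
    by_cases hn : n 2 = 0
    · have hmono : C a * (X 0 ^ n 0 * X 1 ^ n 1 * (0 : MvPolynomial (Fin 3) κ) ^ n 2) = monomial n a := by
        rw [monomial_eq, Finsupp.prod_fintype _ _ (fun i => by simp), Fin.prod_univ_three, hn, pow_zero, pow_zero]
      rw [hmono, coeff_monomial]
      by_cases hnm : n = m
      · subst hnm; simp [hn]
      · simp [hnm]
    · simp only [zero_pow hn, mul_zero, coeff_zero]
      by_cases hm : m 2 = 0
      · rw [if_pos hm]
        by_cases hnm : n = m
        · exact absurd (hnm ▸ hm) hn
        · rw [if_neg hnm]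
      · rw [if_neg hm]
  | add p q hp hq =>
    simp only [map_add, coeff_add, hp, hq]
    split_ifs <;> ring

/-- A polynomial whose support avoids `M` is fixed by killing `M`. [folklore] -/
theorem cone_eq_self_of_forall (G : MvPolynomial (Fin 3) κ) (h : ∀ m ∈ G.support, m 2 = 0) :
    aeval ![X 0, X 1, (0 : MvPolynomial (Fin 3) κ)] G = G := by
  classical
  ext m
  rw [coeff_cone]
  split_ifs with hm
  · rfl
  · by_contra hne
    exact hm (h m (by simpa [mem_support_iff, eq_comm] using hne))

/-- After killing `M` every surviving monomial is `M`-free. [folklore] -/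
theorem apply_two_eq_zero_of_mem_support_cone (G : MvPolynomial (Fin 3) κ) (m : Fin 3 →₀ ℕ)
    (hm : m ∈ (aeval ![X 0, X 1, (0 : MvPolynomial (Fin 3) κ)] G).support) : m 2 = 0 := by
  classical
  rw [mem_support_iff, coeff_cone] at hm
  by_contra h
  exact hm (if_neg h)

/-- The `M`-part `G − G|_{M=0}` has only monomials involving `M`, with the coefficients of `G`. [folklore] -/
theorem coeff_sub_cone (G : MvPolynomial (Fin 3) κ) (m : Fin 3 →₀ ℕ) :
    coeff m (G - aeval ![X 0, X 1, (0 : MvPolynomial (Fin 3) κ)] G) = if m 2 = 0 then 0 else coeff m G := by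
  rw [coeff_sub, coeff_cone]
  split_ifs <;> ring

end AlgebraMaps

section Support

variable {κ : Type} [CommRing κ]

/-- A per-monomial property of the supports of `p` and `q` holds on the support of `p - q`. [folklore] -/
theorem forall_support_sub {P : (Fin 3 →₀ ℕ) → Prop} {p q : MvPolynomial (Fin 3) κ}
    (hp : ∀ m ∈ p.support, P m) (hq : ∀ m ∈ q.support, P m) : ∀ m ∈ (p - q).support, P m := by
  classical
  intro m hm
  rcases Finset.mem_union.mp (support_sub (Fin 3) p q hm) with h | h
  · exact hp m h
  · exact hq m h

/-- A per-monomial property of the supports of `p` and `q` holds on the support of `p + q`. [folklore] -/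
theorem forall_support_add {P : (Fin 3 →₀ ℕ) → Prop} {p q : MvPolynomial (Fin 3) κ}
    (hp : ∀ m ∈ p.support, P m) (hq : ∀ m ∈ q.support, P m) : ∀ m ∈ (p + q).support, P m := by
  classical
  intro m hm
  rcases Finset.mem_union.mp (support_add hm) with h | h
  · exact hp m h
  · exact hq m h

/-- An additively closed per-monomial property propagates to products. [folklore] -/
theorem forall_support_mul {P : (Fin 3 →₀ ℕ) → Prop} (hP : ∀ a b, P a → P b → P (a + b))
    {p q : MvPolynomial (Fin 3) κ} (hp : ∀ m ∈ p.support, P m) (hq : ∀ m ∈ q.support, P m) :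
    ∀ m ∈ (p * q).support, P m := by
  classical
  intro m hm
  obtain ⟨a, ha, b, hb, rfl⟩ := Finset.mem_add.mp (support_mul p q hm)
  exact hP a b (hp a ha) (hq b hb)

/-- A per-monomial property absorbing on the left propagates from the left factor to products. [folklore] -/
theorem forall_support_mul_left {P : (Fin 3 →₀ ℕ) → Prop} (hP : ∀ a b, P a → P (a + b))
    {p q : MvPolynomial (Fin 3) κ} (hp : ∀ m ∈ p.support, P m) : ∀ m ∈ (p * q).support, P m := by
  classical
  intro m hm
  obtain ⟨a, ha, b, _, rfl⟩ := Finset.mem_add.mp (support_mul p q hm)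
  exact hP a b (hp a ha)

/-- An additively closed per-monomial property holding at `0` propagates to powers. [folklore] -/
theorem forall_support_pow {P : (Fin 3 →₀ ℕ) → Prop} (hP : ∀ a b, P a → P b → P (a + b)) (h0 : P 0)
    {p : MvPolynomial (Fin 3) κ} (hp : ∀ m ∈ p.support, P m) (k : ℕ) : ∀ m ∈ (p ^ k).support, P m := by
  classical
  induction k with
  | zero =>
    intro m hm
    rw [pow_zero, ← C_1, C_apply] at hm
    obtain rfl := Finset.mem_singleton.mp (support_monomial_subset hm)
    exact h0
  | succ k ih =>
    rw [pow_succ]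
    exact forall_support_mul hP ih hp

/-- A per-monomial property holding at `n` holds on the support of a monomial / scalar multiple of `X^n`. [folklore] -/
theorem forall_support_C_mul_monomial {P : (Fin 3 →₀ ℕ) → Prop} (a b : κ) (n : Fin 3 →₀ ℕ) (hn : P n) :
    ∀ m ∈ (C a * monomial n b).support, P m := by
  classical
  intro m hm
  rw [C_mul_monomial] at hm
  obtain rfl := Finset.mem_singleton.mp (support_monomial_subset hm)
  exact hn

/-- A per-monomial property of the summands holds on the support of a finite sum. [folklore] -/
theorem forall_support_sum {P : (Fin 3 →₀ ℕ) → Prop} {ι : Type} (s : Finset ι) (f : ι → MvPolynomial (Fin 3) κ)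
    (h : ∀ i ∈ s, ∀ m ∈ (f i).support, P m) : ∀ m ∈ (∑ i ∈ s, f i).support, P m := by
  classical
  intro m hm
  obtain ⟨i, hi, hmi⟩ := Finset.mem_biUnion.mp (support_sum hm)
  exact h i hi m hmi

/-- STABILITY OF THE REMOVABLE SPAN (characteristic `2`): if every monomial of `H` involves `M` and is even-even in `(Z, W)`,
the same holds for every vertex shift of `H` — `(Z + t₁M)^{2i} (W + t₂M)^{2j} M^k = (Z² + t₁²M²)^i (W² + t₂²M²)^j M^k`. [folklore] -/
theorem vertexShift_removable [CharP κ 2] (t₁ t₂ : κ) (H : MvPolynomial (Fin 3) κ)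
    (hH : ∀ m ∈ H.support, 1 ≤ m 2 ∧ Even (m 0) ∧ Even (m 1)) :
    ∀ m ∈ (vertexShift t₁ t₂ H).support, 1 ≤ m 2 ∧ Even (m 0) ∧ Even (m 1) := by
  classical
  haveI : CharP (MvPolynomial (Fin 3) κ) 2 := inferInstance
  -- the two per-monomial properties and their closure
  have hQ : ∀ a b : Fin 3 →₀ ℕ, (Even (a 0) ∧ Even (a 1)) → (Even (b 0) ∧ Even (b 1)) →
      (Even ((a + b) 0) ∧ Even ((a + b) 1)) := fun a b ha hb =>
    ⟨by simpa using ha.1.add hb.1, by simpa using ha.2.add hb.2⟩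
  have hQ0 : Even ((0 : Fin 3 →₀ ℕ) 0) ∧ Even ((0 : Fin 3 →₀ ℕ) 1) := by simp
  -- write H as the sum of its monomials
  rw [H.as_sum, map_sum]
  refine forall_support_sum _ _ fun n hn => ?_
  obtain ⟨hn2, ⟨i, hi⟩, ⟨j, hj⟩⟩ := hH n hn
  -- the shifted monomial, in closed form
  have hsq0 : (X 0 + C t₁ * X 2 : MvPolynomial (Fin 3) κ) ^ n 0 = (X 0 ^ 2 + C (t₁ ^ 2) * X 2 ^ 2) ^ i := by
    rw [hi, ← two_mul, pow_mul, add_pow_char, mul_pow, ← map_pow]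
  have hsq1 : (X 1 + C t₂ * X 2 : MvPolynomial (Fin 3) κ) ^ n 1 = (X 1 ^ 2 + C (t₂ ^ 2) * X 2 ^ 2) ^ j := by
    rw [hj, ← two_mul, pow_mul, add_pow_char, mul_pow, ← map_pow]
  have hexp : vertexShift t₁ t₂ (monomial n (coeff n H)) =
      (C (coeff n H) * (X 0 ^ 2 + C (t₁ ^ 2) * X 2 ^ 2) ^ i * (X 1 ^ 2 + C (t₂ ^ 2) * X 2 ^ 2) ^ j) *
        X 2 ^ n 2 := by
    rw [vertexShift, aeval_monomial, Finsupp.prod_fintype _ _ (fun i => by simp), Fin.prod_univ_three]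
    simp only [Matrix.cons_val_zero, Matrix.cons_val_one, Matrix.cons_val, algebraMap_eq, hsq0, hsq1]
    ring
  rw [hexp]
  -- even-even everywhere, `M` present from the last factor
  have hX0sq : ∀ m ∈ (X 0 ^ 2 + C (t₁ ^ 2) * X 2 ^ 2 : MvPolynomial (Fin 3) κ).support, Even (m 0) ∧ Even (m 1) := by
    refine forall_support_add ?_ ?_
    · intro m hm
      rw [X_pow_eq_monomial] at hm
      obtain rfl := Finset.mem_singleton.mp (support_monomial_subset hm)
      simp
    · rw [X_pow_eq_monomial]
      exact forall_support_C_mul_monomial _ _ _ (by simp)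
  have hX1sq : ∀ m ∈ (X 1 ^ 2 + C (t₂ ^ 2) * X 2 ^ 2 : MvPolynomial (Fin 3) κ).support, Even (m 0) ∧ Even (m 1) := by
    refine forall_support_add ?_ ?_
    · intro m hm
      rw [X_pow_eq_monomial] at hm
      obtain rfl := Finset.mem_singleton.mp (support_monomial_subset hm)
      simp
    · rw [X_pow_eq_monomial]
      exact forall_support_C_mul_monomial _ _ _ (by simp)
  have hA : ∀ m ∈ (C (coeff n H) * (X 0 ^ 2 + C (t₁ ^ 2) * X 2 ^ 2) ^ i *
      (X 1 ^ 2 + C (t₂ ^ 2) * X 2 ^ 2) ^ j : MvPolynomial (Fin 3) κ).support, Even (m 0) ∧ Even (m 1) := by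
    refine forall_support_mul hQ (forall_support_mul hQ ?_ (forall_support_pow hQ hQ0 hX0sq i))
      (forall_support_pow hQ hQ0 hX1sq j)
    intro m hm
    rw [C_apply] at hm
    obtain rfl := Finset.mem_singleton.mp (support_monomial_subset hm)
    exact hQ0
  have hM : ∀ m ∈ (X 2 ^ n 2 : MvPolynomial (Fin 3) κ).support, 1 ≤ m 2 ∧ Even (m 0) ∧ Even (m 1) := by
    intro m hm
    rw [X_pow_eq_monomial] at hm
    obtain rfl := Finset.mem_singleton.mp (support_monomial_subset hm)
    simpa using hn2
  intro m hm
  obtain ⟨a, ha, b, hb, rfl⟩ := Finset.mem_add.mp (support_mul _ _ hm)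
  obtain ⟨hb2, hbe⟩ := hM b hb
  refine ⟨?_, hQ a b (hA a ha) hbe⟩
  simp only [Finsupp.coe_add, Pi.add_apply]; omega

end Support

section Derivatives

variable {κ : Type} [CommRing κ]

/-- In characteristic `2`, a polynomial all of whose monomials have an even exponent in the variable `i` has `∂_i = 0`. [folklore] -/
theorem pderiv_eq_zero_of_forall_even [CharP κ 2] (i : Fin 3) (H : MvPolynomial (Fin 3) κ)
    (h : ∀ m ∈ H.support, Even (m i)) : pderiv i H = 0 := by
  classical
  ext m
  rw [coeff_pderiv, coeff_zero]
  by_cases hm : m + Finsupp.single i 1 ∈ H.support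
  · have hev : Even (m i + 1) := by simpa using h _ hm
    have hcast : ((m i : κ) + 1) = 0 := by
      have := (CharP.cast_eq_zero_iff κ 2 (m i + 1)).mpr (even_iff_two_dvd.mp hev)
      push_cast at this
      exact this
    rw [hcast, mul_zero]
  · rw [notMem_support_iff.mp hm, zero_mul]

/-- Chain rule: `∂_Z` commutes with every vertex shift (`∂_Z (Z + t₁M) = 1`, `∂_Z (W + t₂M) = ∂_Z M = 0`). [folklore] -/
theorem pderiv_zero_vertexShift (t₁ t₂ : κ) (G : MvPolynomial (Fin 3) κ) :
    pderiv 0 (vertexShift t₁ t₂ G) = vertexShift t₁ t₂ (pderiv 0 G) := by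
  classical
  induction G using MvPolynomial.induction_on with
  | C a => simp [vertexShift]
  | add p q hp hq => simp only [map_add, hp, hq]
  | mul_X p n hp =>
    rw [map_mul, Derivation.leibniz, Derivation.leibniz, map_add, smul_eq_mul, smul_eq_mul, smul_eq_mul, smul_eq_mul,
      map_mul, map_mul, hp]
    congr 1
    fin_cases n <;> simp [pderiv_X]

/-- Chain rule: `∂_W` commutes with every vertex shift. [folklore] -/
theorem pderiv_one_vertexShift (t₁ t₂ : κ) (G : MvPolynomial (Fin 3) κ) :
    pderiv 1 (vertexShift t₁ t₂ G) = vertexShift t₁ t₂ (pderiv 1 G) := by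
  classical
  induction G using MvPolynomial.induction_on with
  | C a => simp [vertexShift]
  | add p q hp hq => simp only [map_add, hp, hq]
  | mul_X p n hp =>
    rw [map_mul, Derivation.leibniz, Derivation.leibniz, map_add, smul_eq_mul, smul_eq_mul, smul_eq_mul, smul_eq_mul,
      map_mul, map_mul, hp]
    congr 1
    fin_cases n <;> simp [pderiv_X]

/-- Chain rule: `∂_Z` commutes with killing `M`. [folklore] -/
theorem pderiv_zero_cone (G : MvPolynomial (Fin 3) κ) :
    pderiv 0 (aeval ![X 0, X 1, (0 : MvPolynomial (Fin 3) κ)] G) =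
      aeval ![X 0, X 1, (0 : MvPolynomial (Fin 3) κ)] (pderiv 0 G) := by
  classical
  induction G using MvPolynomial.induction_on with
  | C a => simp
  | add p q hp hq => simp only [map_add, hp, hq]
  | mul_X p n hp =>
    rw [map_mul, Derivation.leibniz, Derivation.leibniz, map_add, smul_eq_mul, smul_eq_mul, smul_eq_mul, smul_eq_mul,
      map_mul, map_mul, hp]
    congr 1
    fin_cases n <;> simp [pderiv_X]

/-- Chain rule: `∂_W` commutes with killing `M`. [folklore] -/
theorem pderiv_one_cone (G : MvPolynomial (Fin 3) κ) :
    pderiv 1 (aeval ![X 0, X 1, (0 : MvPolynomial (Fin 3) κ)] G) =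
      aeval ![X 0, X 1, (0 : MvPolynomial (Fin 3) κ)] (pderiv 1 G) := by
  classical
  induction G using MvPolynomial.induction_on with
  | C a => simp
  | add p q hp hq => simp only [map_add, hp, hq]
  | mul_X p n hp =>
    rw [map_mul, Derivation.leibniz, Derivation.leibniz, map_add, smul_eq_mul, smul_eq_mul, smul_eq_mul, smul_eq_mul,
      map_mul, map_mul, hp]
    congr 1
    fin_cases n <;> simp [pderiv_X]

end Derivatives


end Summit.ResolutionOfSingularities.ResolutionOfSingularities.Theorems.SwitchingDichotomy.VertexDescent
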